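import Literature.NumberTheory.Automorphic.ArchInnerFormCartanAtlasRegular   -- ★ (T-ATLAS) PART 2b∕reg: `gprimeTorus`, `gprimeBlock`, `boostEig`, `charpoly_map_evalC_gprimeTorus`, `RegG`
import Literature.NumberTheory.Rogawski1990.ArchHCSpaceG                      -- ★ `hcSwapAt` (slot transpositions at a place)
import HarnessLib

/-!
# THE STABLE-CLASS MAP OF THE `G′`∕`G`-CHARTS: `bzClassMapG S′ c = (σ₁, σ₂, σ₃)(eigenvalues of γ_w(c))_w`, the class map `bzClassG` on the group, and the cubic
# discriminant `cubicDisc` (Bouaziz 1994 §2.3, §5.1; Rogawski 1990 §3.6, §4.3)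

Topic `NumberTheory/Rogawski1990`; namespace `Literature.NumberTheory.Rogawski1990`.  Definitions WITH BODIES and theorems (no instance, no notation, no axiom, no named
fact, no `sorry`).  Cell `pub/hodgecm-mathlib`, crux H413 (`stmt-HodgeConjecture-24833`), road «N8-INNER» (LEAD T14-4, owner LH2-plan (g1), DEAL #1 2026-09-02T15:34Z), brick
**(7) «(Σ-REG-G)»**, FILE F0 — the vocabulary of local surjectivity at regular base classes on the `G`-side: the 3 × 3 twin of ★ `ArchBouazizClassMap` (`bzClassMap S c =
(tr, det, u)` of the `H`-charts) and of ★ `ArchBouazizClassMultiplier` §2 (`bzClassH`).  Author LH3-p04 (g7).  Count-neutral.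

THE MATHEMATICS.  A chart point `(S′, c)` of the `G′`-atlas (★ `gprimeTorus α S′ c`) has, at the complex place `w`, the eigenvalue triple ★ `boostEig (c w) =
(e^{x+iθ}, e^{iφ}, e^{−x+iθ})` (`x = c w 0`, `φ = c w 1`, `θ = c w 2`) if `w ∈ S′` and `(e^{i c w 0}, e^{i c w 1}, e^{i c w 2})` if `w ∉ S′` (★ `charpoly_map_evalC_gprimeTorus`).
Two elements of `U(2,1)` (or `U(3)`) are STABLY conjugate iff they are `GL₃(ℂ)`-conjugate iff (for semisimple elements) their characteristic polynomials agree, i.e. iff the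
elementary symmetric functions `(σ₁, σ₂, σ₃)` of their eigenvalue triples agree place by place.  So the STABLE-CLASS DATA of a chart point are
`bzClassMapG S′ c w := (σ₁, σ₂, σ₃)(eigenvalue triple at w)`, read on the group by `bzClassG α g w := (σ₁, σ₂, σ₃)` = the coefficients of the characteristic polynomial of the
`w`-component of `g` (`X³ − σ₁X² + σ₂X − σ₃`).  The triple is REGULAR (pairwise distinct) iff the cubic discriminant
`cubicDisc (σ₁, σ₂, σ₃) = σ₁²σ₂² − 4σ₂³ − 4σ₁³σ₃ + 18σ₁σ₂σ₃ − 27σ₃² = ∏_{i<j} (λ_i − λ_j)²` is non-zero — the 3 × 3 replacement of ★'s `tr² ≠ 4·det`.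
* §1 `esymm3`, `cubicDisc`, `cubicDisc_esymm3` (`= ((λ₀−λ₁)(λ₀−λ₂)(λ₁−λ₂))²`), `cubicDisc_esymm3_ne_zero_iff` (`↔ Injective λ`), `esymm3_comp_equiv` (symmetry).
* §2 `chartEigG S′ c w` (the eigenvalue triple of a chart point), `bzClassMapG`; periodicity under ★ `angleShift`, invariance under EVERY slot permutation at a compact place (the
  STABLE Weyl group `S₃`, in particular ★ `hcSwapAt w i j` for all `i, j`) and under ★ `negXAt` at a split place; `continuous_bzClassMapG`; regularity:
  **`mem_regG_iff_forall_cubicDisc_ne_zero`** (`c ∈ RegG S′ ↔ ∀ w, cubicDisc (bzClassMapG S′ c w) ≠ 0`).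
* §3 `bzClassG α g w` on `G′_∞ = U(diag α)(L⁺ ⊗ ℝ)` (charpoly coefficients of the place component, ★ `archPiEquivCM`), `bzClassG_conj` (a class function), and
  **`bzClassG_gprimeTorus : bzClassG α (gprimeTorus α S′ c) = bzClassMapG S′ c`** for admissible `S′` (★ `charpoly_map_evalC_gprimeTorus` + Vieta on `Fin 3`).
HONEST LABEL: HC_CM is proved only modulo the 7 printed citations (2 remaining: hLiu418 = stmt-HodgeConjecture-24832, h413 = stmt-HodgeConjecture-24833) until rung 0 closes; this
file is chart vocabulary and pays nothing by itself.

## References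
* [Bouaziz1994IntegralesOrbitales] A. Bouaziz, *Intégrales orbitales sur les groupes de Lie réductifs*, Ann. Sci. ÉNS (4) 27 (1994) 573–609, §2.3 p. 578, §5.1 p. 588.
* [Rogawski1990] J. D. Rogawski, *Automorphic Representations of Unitary Groups in Three Variables*, Ann. of Math. Stud. 123 (1990), §3.6 p. 28 (Cartan subgroups and stable
  conjugacy by characteristic polynomial), §4.3 p. 42 (regular elements, the Weyl discriminant).
* [Shelstad1979] D. Shelstad, *Characters and inner forms of a quasi-split group over ℝ*, Compositio Math. 39 (1979), §4 pp. 22–23.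
-/

set_option autoImplicit false

noncomputable section

open Complex Set Function Real Polynomial NumberField NumberField.InfinitePlace NumberField.mixedEmbedding
open Literature.NumberTheory.Automorphic Literature.NumberTheory.Automorphic.UnitaryGroup Literature.NumberTheory.Automorphic.ArchCartan
open scoped MatrixGroups Matrix Classical

namespace Literature.NumberTheory.Rogawski1990

/-! ## §1 Elementary symmetric data of a triple and the cubic discriminant -/

section Esymm

/-- The elementary symmetric data `(σ₁, σ₂, σ₃)` of a triple `λ : Fin 3 → ℂ`. [cite: Rogawski1990, §3.6 p. 28] -/
def esymm3 (l : Fin 3 → ℂ) : ℂ × ℂ × ℂ :=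
  (l 0 + l 1 + l 2, l 0 * l 1 + l 0 * l 2 + l 1 * l 2, l 0 * l 1 * l 2)

/-- **The cubic discriminant** of the data `(σ₁, σ₂, σ₃)` (discriminant of `X³ − σ₁X² + σ₂X − σ₃`): `σ₁²σ₂² − 4σ₂³ − 4σ₁³σ₃ + 18σ₁σ₂σ₃ − 27σ₃²`.
[cite: Rogawski1990, §4.3 p. 42] -/
def cubicDisc (b : ℂ × ℂ × ℂ) : ℂ :=
  b.1 ^ 2 * b.2.1 ^ 2 - 4 * b.2.1 ^ 3 - 4 * b.1 ^ 3 * b.2.2 + 18 * b.1 * b.2.1 * b.2.2 - 27 * b.2.2 ^ 2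

/-- Unfolding of `esymm3`. [cite: Rogawski1990, §3.6 p. 28] -/
theorem esymm3_apply (l : Fin 3 → ℂ) : esymm3 l = (l 0 + l 1 + l 2, l 0 * l 1 + l 0 * l 2 + l 1 * l 2, l 0 * l 1 * l 2) := rfl

/-- Unfolding of `cubicDisc`. [cite: Rogawski1990, §4.3 p. 42] -/
theorem cubicDisc_apply (b : ℂ × ℂ × ℂ) :
    cubicDisc b = b.1 ^ 2 * b.2.1 ^ 2 - 4 * b.2.1 ^ 3 - 4 * b.1 ^ 3 * b.2.2 + 18 * b.1 * b.2.1 * b.2.2 - 27 * b.2.2 ^ 2 := rfl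

/-- **`cubicDisc (σ(λ)) = ((λ₀ − λ₁)(λ₀ − λ₂)(λ₁ − λ₂))²`** — the Weyl discriminant of the triple. [cite: Rogawski1990, §4.3 p. 42] -/
theorem cubicDisc_esymm3 (l : Fin 3 → ℂ) : cubicDisc (esymm3 l) = ((l 0 - l 1) * (l 0 - l 2) * (l 1 - l 2)) ^ 2 := by
  simp only [cubicDisc, esymm3]
  ring

/-- **Regularity read on the class data**: `cubicDisc (σ(λ)) ≠ 0 ↔ λ` is injective (pairwise distinct eigenvalues). [cite: Rogawski1990, §4.3 p. 42] -/
theorem cubicDisc_esymm3_ne_zero_iff (l : Fin 3 → ℂ) : cubicDisc (esymm3 l) ≠ 0 ↔ Function.Injective l := by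
  rw [cubicDisc_esymm3, pow_ne_zero_iff two_ne_zero, mul_ne_zero_iff, mul_ne_zero_iff, sub_ne_zero, sub_ne_zero, sub_ne_zero]
  constructor
  · rintro ⟨⟨h01, h02⟩, h12⟩ i j hij
    fin_cases i <;> fin_cases j
    · rfl
    · exact absurd hij h01
    · exact absurd hij h02
    · exact absurd hij.symm h01
    · rfl
    · exact absurd hij h12
    · exact absurd hij.symm h02
    · exact absurd hij.symm h12
    · rfl
  · intro h
    exact ⟨⟨fun e => absurd (h e) (by decide), fun e => absurd (h e) (by decide)⟩, fun e => absurd (h e) (by decide)⟩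

/-- The symmetric data are invariant under every permutation of the slots. [cite: Shelstad1979, §4 p. 23] -/
theorem esymm3_comp_equiv (l : Fin 3 → ℂ) (τ : Equiv.Perm (Fin 3)) : esymm3 (l ∘ τ) = esymm3 l := by
  have h1 : ∑ i, l (τ i) = ∑ i, l i := Equiv.sum_comp τ l
  have h2 : ∑ i, l (τ i) ^ 2 = ∑ i, l i ^ 2 := Equiv.sum_comp τ (fun i => l i ^ 2)
  have h3 : ∏ i, l (τ i) = ∏ i, l i := Equiv.prod_comp τ l
  simp only [Fin.sum_univ_three, Fin.prod_univ_three] at h1 h2 h3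
  simp only [esymm3, Function.comp_apply, Prod.mk.injEq]
  refine ⟨h1, ?_, h3⟩
  linear_combination (1 / 2 : ℂ) * (l (τ 0) + l (τ 1) + l (τ 2) + (l 0 + l 1 + l 2)) * h1 - (1 / 2 : ℂ) * h2

/-- The cubic discriminant of permuted data is unchanged. [cite: Shelstad1979, §4 p. 23] -/
theorem cubicDisc_esymm3_comp_equiv (l : Fin 3 → ℂ) (τ : Equiv.Perm (Fin 3)) : cubicDisc (esymm3 (l ∘ τ)) = cubicDisc (esymm3 l) := by
  rw [esymm3_comp_equiv]

/-- **VIETA on `Fin 3`**: the coefficients of `∏_i (X − λ_i)` are `(1, −σ₁, σ₂, −σ₃)`. [cite: Rogawski1990, §3.6 p. 28] -/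
theorem coeff_prod_X_sub_C_fin_three (l : Fin 3 → ℂ) :
    (∏ i : Fin 3, (X - Polynomial.C (l i))).coeff 2 = -(esymm3 l).1 ∧ (∏ i : Fin 3, (X - Polynomial.C (l i))).coeff 1 = (esymm3 l).2.1 ∧
      (∏ i : Fin 3, (X - Polynomial.C (l i))).coeff 0 = -(esymm3 l).2.2 := by
  have h : ∏ i : Fin 3, (X - Polynomial.C (l i)) =
      X ^ 3 - Polynomial.C (l 0 + l 1 + l 2) * X ^ 2 + Polynomial.C (l 0 * l 1 + l 0 * l 2 + l 1 * l 2) * X - Polynomial.C (l 0 * l 1 * l 2) := by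
    rw [Fin.prod_univ_three]
    simp only [map_add, map_mul]
    ring
  rw [h]
  simp only [esymm3, coeff_sub, coeff_add, coeff_C_mul, coeff_X_pow, coeff_X, coeff_C, mul_ite, mul_one, mul_zero]
  norm_num

end Esymm

/-! ## §2 The class map of the `G′`∕`G`-charts -/

section ClassMap

variable {W : Type*} [DecidableEq W]

/-- **The eigenvalue triple of the chart point `(S′, c)` at the place `w`**: ★ `boostEig (c w) = (e^{x+iθ}, e^{iφ}, e^{−x+iθ})` at a noncompact place `w ∈ S′`, the unit triple
`(e^{i c w 0}, e^{i c w 1}, e^{i c w 2})` at a compact place (★ `charpoly_map_evalC_gprimeTorus`). [cite: Rogawski1990, §3.6 p. 28; §4.3 p. 42] -/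
def chartEigG (S' : Finset W) (c : W → Fin 3 → ℝ) (w : W) : Fin 3 → ℂ :=
  if w ∈ S' then boostEig (c w) else fun i => Complex.exp ((c w i : ℂ) * I)

/-- **THE STABLE-CLASS MAP OF A CHART POINT**: `bzClassMapG S′ c w := (σ₁, σ₂, σ₃)` of the eigenvalue triple at `w` — two chart points represent STABLY conjugate elements iff
their class data agree (semisimple elements of `GL₃(ℂ)` are conjugate iff their characteristic polynomials agree). The 3 × 3 twin of ★ `bzClassMap`.
[cite: Bouaziz1994IntegralesOrbitales, §2.3 p. 578; §5.1 p. 588] [cite: Rogawski1990, §3.6 p. 28] -/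
def bzClassMapG (S' : Finset W) (c : W → Fin 3 → ℝ) (w : W) : ℂ × ℂ × ℂ :=
  esymm3 (chartEigG S' c w)

/-- The eigenvalue triple at a noncompact place. [cite: Rogawski1990, §3.6 p. 28] -/
theorem chartEigG_of_mem {S' : Finset W} {w : W} (hw : w ∈ S') (c : W → Fin 3 → ℝ) : chartEigG S' c w = boostEig (c w) := by
  rw [chartEigG, if_pos hw]

/-- The eigenvalue triple at a compact place. [cite: Rogawski1990, §3.6 p. 28] -/
theorem chartEigG_of_not_mem {S' : Finset W} {w : W} (hw : w ∉ S') (c : W → Fin 3 → ℝ) : chartEigG S' c w = fun i => Complex.exp ((c w i : ℂ) * I) := by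
  rw [chartEigG, if_neg hw]

/-- Unfolding of `bzClassMapG`. [cite: Bouaziz1994IntegralesOrbitales, §5.1 p. 588] -/
theorem bzClassMapG_apply (S' : Finset W) (c : W → Fin 3 → ℝ) (w : W) : bzClassMapG S' c w = esymm3 (chartEigG S' c w) := rfl

/-- The eigenvalue triple reads the place `w` only through `c w`. [cite: Bouaziz1994IntegralesOrbitales, §5.1 p. 588] -/
theorem chartEigG_congr (S' : Finset W) {c c' : W → Fin 3 → ℝ} {w : W} (h : c w = c' w) : chartEigG S' c w = chartEigG S' c' w := by
  simp only [chartEigG, h]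

/-- The class map reads the place `w` only through `c w`. [cite: Bouaziz1994IntegralesOrbitales, §5.1 p. 588] -/
theorem bzClassMapG_congr (S' : Finset W) {c c' : W → Fin 3 → ℝ} {w : W} (h : c w = c' w) : bzClassMapG S' c w = bzClassMapG S' c' w := by
  rw [bzClassMapG_apply, bzClassMapG_apply, chartEigG_congr S' h]

/-- `e^{i(t + 2πk)} = e^{it}` in the `Complex.exp ((t : ℂ) * I)` spelling. [cite: Rogawski1990, §8.2 p. 118] -/
theorem cexp_mul_I_add_two_pi_mul (t : ℝ) (k : ℤ) : Complex.exp (((t + 2 * π * k : ℝ) : ℂ) * I) = Complex.exp ((t : ℂ) * I) := by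
  have h : ((t + 2 * π * k : ℝ) : ℂ) * I = (t : ℂ) * I + k * (2 * π * I) := by push_cast; ring
  rw [h, Complex.exp_add, Complex.exp_int_mul_two_pi_mul_I, mul_one]

/-- `boostEig` in factorised form: `(eˣ·e^{iθ}, e^{iφ}, e^{−x}·e^{iθ})`. [cite: Rogawski1990, §3.6 p. 28] -/
theorem boostEig_eq_mul (x : Fin 3 → ℝ) :
    boostEig x = ![Complex.exp (x 0 : ℂ) * Complex.exp ((x 2 : ℂ) * I), Complex.exp ((x 1 : ℂ) * I), Complex.exp (-(x 0 : ℂ)) * Complex.exp ((x 2 : ℂ) * I)] := by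
  simp only [boostEig, Complex.exp_add]

/-- **`2π`-PERIODICITY IN EVERY ANGLE**: the eigenvalue triple is unchanged by ★ `angleShift w i k` at an angle slot (`w ∉ S′`, or `i ≠ 0`).
[cite: Shelstad1979, §4 p. 22] [cite: Bouaziz1994IntegralesOrbitales, §5.1 p. 588] -/
theorem chartEigG_add_angleShift (S' : Finset W) (c : W → Fin 3 → ℝ) {w : W} {i : Fin 3} (h : w ∉ S' ∨ i ≠ 0) (k : ℤ) :
    chartEigG S' (c + angleShift w i k) = chartEigG S' c := by
  funext w'
  by_cases hw' : w' = w
  · subst hw'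
    -- every ANGLE slot reads `e^{i(t + 2πk)} = e^{it}` or is untouched
    have hslot : ∀ j : Fin 3, Complex.exp (((c + angleShift w' i k) w' j : ℂ) * I) = Complex.exp ((c w' j : ℂ) * I) := by
      intro j
      rw [Pi.add_apply, Pi.add_apply]
      by_cases hj : j = i
      · subst hj
        rw [angleShift_apply_self]
        exact cexp_mul_I_add_two_pi_mul _ _
      · rw [angleShift_apply_self_of_ne w' hj, add_zero]
    by_cases hS : w' ∈ S'
    · have hi : i ≠ 0 := h.resolve_left (fun h' => h' hS)
      have h0 : (c + angleShift w' i k) w' 0 = c w' 0 := by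
        rw [Pi.add_apply, Pi.add_apply, angleShift_apply_self_of_ne w' (Ne.symm hi), add_zero]
      rw [chartEigG_of_mem hS, chartEigG_of_mem hS, boostEig_eq_mul, boostEig_eq_mul, h0, hslot 1, hslot 2]
    · rw [chartEigG_of_not_mem hS, chartEigG_of_not_mem hS]
      funext j
      exact hslot j
  · exact chartEigG_congr S' (by rw [Pi.add_apply, angleShift_apply_of_ne hw', add_zero])

/-- **`2π`-PERIODICITY of the class map.** [cite: Shelstad1979, §4 p. 22] -/
theorem bzClassMapG_add_angleShift (S' : Finset W) (c : W → Fin 3 → ℝ) {w : W} {i : Fin 3} (h : w ∉ S' ∨ i ≠ 0) (k : ℤ) :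
    bzClassMapG S' (c + angleShift w i k) = bzClassMapG S' c := by
  funext w'
  rw [bzClassMapG_apply, bzClassMapG_apply, chartEigG_add_angleShift S' c h k]

/-- **STABLE WEYL INVARIANCE AT A COMPACT PLACE**: permuting the three angle slots at `w ∉ S′` (ANY permutation — the stable Weyl group `S₃`, realised or not) permutes the
eigenvalue triple and leaves the class data unchanged. [cite: Shelstad1979, §4 p. 23] [cite: Rogawski1990, §3.6 p. 28] -/
theorem bzClassMapG_update_comp_equiv (S' : Finset W) {w : W} (hw : w ∉ S') (c : W → Fin 3 → ℝ) (τ : Equiv.Perm (Fin 3)) :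
    bzClassMapG S' (Function.update c w (c w ∘ τ)) = bzClassMapG S' c := by
  funext w'
  by_cases hw' : w' = w
  · subst hw'
    rw [bzClassMapG_apply, bzClassMapG_apply, chartEigG_of_not_mem hw, chartEigG_of_not_mem hw, Function.update_self]
    exact esymm3_comp_equiv (fun i => Complex.exp ((c w' i : ℂ) * I)) τ
  · exact bzClassMapG_congr S' (Function.update_of_ne hw' _ _)

/-- The class data are invariant under EVERY slot transposition ★ `hcSwapAt w i j` at a compact place (no sign guard: `(0,2)` and `(1,2)` included).
[cite: Shelstad1979, §4 p. 23] -/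
theorem bzClassMapG_hcSwapAt (S' : Finset W) {w : W} (hw : w ∉ S') (i j : Fin 3) (c : W → Fin 3 → ℝ) :
    bzClassMapG S' (hcSwapAt w i j c) = bzClassMapG S' c :=
  bzClassMapG_update_comp_equiv S' hw c (Equiv.swap i j)

/-- **SIGN-CHANGE INVARIANCE AT A NONCOMPACT PLACE**: `x ↦ −x` (★ `negXAt`, the realised real reflection) swaps `e^{x+iθ} ↔ e^{−x+iθ}`. [cite: Shelstad1979, §4 p. 23] -/
theorem bzClassMapG_negXAt (S' : Finset W) {w : W} (hw : w ∈ S') (c : W → Fin 3 → ℝ) : bzClassMapG S' (negXAt w c) = bzClassMapG S' c := by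
  funext w'
  by_cases hw' : w' = w
  · subst hw'
    rw [bzClassMapG_apply, bzClassMapG_apply, chartEigG_of_mem hw, chartEigG_of_mem hw, negXAt_apply_self]
    have h : boostEig ![-c w' 0, c w' 1, c w' 2] = boostEig (c w') ∘ Equiv.swap 0 2 := by
      funext i
      fin_cases i
      · simp [boostEig]
      · simp [boostEig, Equiv.swap_apply_of_ne_of_ne]
      · simp [boostEig]
    rw [h]
    exact esymm3_comp_equiv _ _
  · exact bzClassMapG_congr S' (negXAt_apply_of_ne hw' c)

/-- The eigenvalue triple is continuous in the coordinates. [cite: Bouaziz1994IntegralesOrbitales, §2.3 p. 578] -/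
theorem continuous_chartEigG (S' : Finset W) (w : W) : Continuous fun c : W → Fin 3 → ℝ => chartEigG S' c w := by
  by_cases hw : w ∈ S'
  · simp only [chartEigG, if_pos hw]
    refine continuous_pi fun i => ?_
    fin_cases i
    · exact (show Continuous fun c : W → Fin 3 → ℝ => Complex.exp ((c w 0 : ℂ) + (c w 2 : ℂ) * I) by fun_prop)
    · exact (show Continuous fun c : W → Fin 3 → ℝ => Complex.exp ((c w 1 : ℂ) * I) by fun_prop)
    · exact (show Continuous fun c : W → Fin 3 → ℝ => Complex.exp (-(c w 0 : ℂ) + (c w 2 : ℂ) * I) by fun_prop)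
  · simp only [chartEigG, if_neg hw]
    exact continuous_pi fun i => by fun_prop

/-- **The class map is continuous** in the coordinates. [cite: Bouaziz1994IntegralesOrbitales, §2.3 p. 578] -/
theorem continuous_bzClassMapG (S' : Finset W) : Continuous fun c : W → Fin 3 → ℝ => bzClassMapG S' c := by
  refine continuous_pi fun w => ?_
  have h := continuous_chartEigG S' w
  simp only [bzClassMapG, esymm3]
  fun_prop

/-- **REGULARITY IS READ ON THE CLASS DATA**: `c ∈ RegG S′ ↔ ∀ w, cubicDisc (bzClassMapG S′ c w) ≠ 0` — at a compact place the unit triple is injective, at a noncompact place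
`x ≠ 0` (then the moduli `eˣ, 1, e⁻ˣ` are distinct). The 3 × 3 replacement of ★ `mem_regS_of_sq_ne_four_mul`. [cite: Rogawski1990, §4.3 p. 42] [cite: Shelstad1979, §4 p. 22] -/
theorem mem_regG_iff_forall_cubicDisc_ne_zero (S' : Finset W) (c : W → Fin 3 → ℝ) :
    c ∈ RegG S' ↔ ∀ w, cubicDisc (bzClassMapG S' c w) ≠ 0 := by
  rw [mem_regG_iff]
  have key : ∀ w, cubicDisc (bzClassMapG S' c w) ≠ 0 ↔
      (w ∉ S' → Function.Injective fun i : Fin 3 => Circle.exp (c w i)) ∧ (w ∈ S' → c w 0 ≠ 0) := by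
    intro w
    rw [bzClassMapG_apply, cubicDisc_esymm3_ne_zero_iff]
    by_cases hw : w ∈ S'
    · rw [chartEigG_of_mem hw, injective_boostEig_iff]
      exact ⟨fun h => ⟨fun h' => absurd hw h', fun _ => h⟩, fun h => h.2 hw⟩
    · rw [chartEigG_of_not_mem hw]
      have e : (Function.Injective fun i : Fin 3 => Complex.exp ((c w i : ℂ) * I)) ↔ Function.Injective fun i : Fin 3 => Circle.exp (c w i) := by
        constructor
        · intro h i j hij
          exact h (by simpa only [Circle.coe_exp] using congrArg (fun z : Circle => (z : ℂ)) hij)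
        · intro h i j hij
          refine h (Subtype.ext ?_)
          simpa only [Circle.coe_exp] using hij
      rw [e]
      exact ⟨fun h => ⟨fun _ => h, fun h' => absurd h' hw⟩, fun h => h.1 hw⟩
  simp only [key]
  exact ⟨fun h w => ⟨h.1 w, h.2 w⟩, fun h => ⟨fun w => (h w).1, fun w => (h w).2⟩⟩

end ClassMap

/-! ## §3 The class map on the group `G′_∞ = U(diag α)(L⁺ ⊗ ℝ)` -/

section ClassG

variable (L : Type) [Field L] [NumberField L] [IsCMField L] (α : Fin 3 → L)

/-- **The CLASS MAP on the group**: `g ↦ (σ₁, σ₂, σ₃)_w`, the coefficients of the characteristic polynomial `X³ − σ₁X² + σ₂X − σ₃` of the `w`-component of `g`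
(★ `archPiEquivCM`).  A polynomial in the matrix entries, constant on conjugacy classes (`bzClassG_conj`) and on STABLE classes (its value at a chart point is `bzClassMapG`,
`bzClassG_gprimeTorus`). The 3 × 3 twin of ★ `bzClassH`. [cite: Bouaziz1994IntegralesOrbitales, §2.3 p. 578] [cite: Rogawski1990, §3.6 p. 28] -/
def bzClassG (g : ↥(arch (↥(maximalRealSubfield L)) L (IsCMField.complexConj L) 3 (Matrix.diagonal α))) (w : {w : InfinitePlace L // IsComplex w}) : ℂ × ℂ × ℂ :=
  (-((archPiEquivCM 3 L (Matrix.diagonal α) g w : GL (Fin 3) ℂ) : Matrix (Fin 3) (Fin 3) ℂ).charpoly.coeff 2,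
    ((archPiEquivCM 3 L (Matrix.diagonal α) g w : GL (Fin 3) ℂ) : Matrix (Fin 3) (Fin 3) ℂ).charpoly.coeff 1,
    -((archPiEquivCM 3 L (Matrix.diagonal α) g w : GL (Fin 3) ℂ) : Matrix (Fin 3) (Fin 3) ℂ).charpoly.coeff 0)

/-- Unfolding of `bzClassG`. [cite: Rogawski1990, §3.6 p. 28] -/
theorem bzClassG_apply (g : ↥(arch (↥(maximalRealSubfield L)) L (IsCMField.complexConj L) 3 (Matrix.diagonal α))) (w : {w : InfinitePlace L // IsComplex w}) :
    bzClassG L α g w =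
      (-((archPiEquivCM 3 L (Matrix.diagonal α) g w : GL (Fin 3) ℂ) : Matrix (Fin 3) (Fin 3) ℂ).charpoly.coeff 2,
        ((archPiEquivCM 3 L (Matrix.diagonal α) g w : GL (Fin 3) ℂ) : Matrix (Fin 3) (Fin 3) ℂ).charpoly.coeff 1,
        -((archPiEquivCM 3 L (Matrix.diagonal α) g w : GL (Fin 3) ℂ) : Matrix (Fin 3) (Fin 3) ℂ).charpoly.coeff 0) :=
  rfl

/-- **The class map is a CLASS FUNCTION**: `bzClassG α (h * g * h⁻¹) = bzClassG α g` (the characteristic polynomial is conjugation invariant, Mathlib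
`Matrix.charpoly_units_conj`). [cite: Bouaziz1994IntegralesOrbitales, §2.3 p. 578] -/
theorem bzClassG_conj (h g : ↥(arch (↥(maximalRealSubfield L)) L (IsCMField.complexConj L) 3 (Matrix.diagonal α))) : bzClassG L α (h * g * h⁻¹) = bzClassG L α g := by
  funext w
  have hc : ((archPiEquivCM 3 L (Matrix.diagonal α) (h * g * h⁻¹) w : GL (Fin 3) ℂ) : Matrix (Fin 3) (Fin 3) ℂ).charpoly =
      ((archPiEquivCM 3 L (Matrix.diagonal α) g w : GL (Fin 3) ℂ) : Matrix (Fin 3) (Fin 3) ℂ).charpoly := by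
    simp only [map_mul, map_inv, Pi.mul_apply, Pi.inv_apply, Subgroup.coe_mul, Subgroup.coe_inv, Units.val_mul]
    rw [Matrix.coe_units_inv]
    exact Matrix.charpoly_units_conj _ _
  rw [bzClassG_apply, bzClassG_apply, hc]

/-- **THE CLASS OF A CHART POINT**: `bzClassG α (gprimeTorus α S′ c) = bzClassMapG S′ c` for an admissible label (`S′ ⊆` split-chart places) — ★ `charpoly_map_evalC_gprimeTorus`
gives `∏_i (X − λ_{w,i})` with `λ_w = chartEigG S′ c w`, and Vieta reads off `(σ₁, σ₂, σ₃)`. [cite: Rogawski1990, §3.6 p. 28; §4.3 p. 42] -/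
theorem bzClassG_gprimeTorus (S' : Finset {w : InfinitePlace L // IsComplex w}) (hS' : ∀ w, w ∈ S' → w ∈ splitChartPlaces L α)
    (c : {w : InfinitePlace L // IsComplex w} → Fin 3 → ℝ) : bzClassG L α (gprimeTorus L α S' c) = bzClassMapG S' c := by
  funext w
  have hchar : ((archPiEquivCM 3 L (Matrix.diagonal α) (gprimeTorus L α S' c) w : GL (Fin 3) ℂ) : Matrix (Fin 3) (Fin 3) ℂ).charpoly =
      ∏ i : Fin 3, (X - Polynomial.C (chartEigG S' c w i)) := by
    rw [coe_archPiEquivCM_apply]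
    have h := charpoly_map_evalC_gprimeTorus L α S' c hS' w
    have hcoe : ((Matrix.GeneralLinearGroup.map (evalC L w)
          ((gprimeTorus L α S' c : arch (↥(maximalRealSubfield L)) L (IsCMField.complexConj L) 3 (Matrix.diagonal α)) : GL (Fin 3) (mixedSpace L)) : GL (Fin 3) ℂ) :
          Matrix (Fin 3) (Fin 3) ℂ) =
        (((gprimeTorus L α S' c : arch (↥(maximalRealSubfield L)) L (IsCMField.complexConj L) 3 (Matrix.diagonal α)) : GL (Fin 3) (mixedSpace L)) :
          Matrix (Fin 3) (Fin 3) (mixedSpace L)).map (evalC L w) := rfl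
    rw [hcoe, h]
    simp only [chartEigG]
  obtain ⟨h2, h1, h0⟩ := coeff_prod_X_sub_C_fin_three (chartEigG S' c w)
  rw [bzClassG_apply, hchar, h2, h1, h0, neg_neg, neg_neg, bzClassMapG_apply]

end ClassG

end Literature.NumberTheory.Rogawski1990

end
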